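import Mathlib.AlgebraicGeometry.Morphisms.FlatRank
import Mathlib.AlgebraicGeometry.Morphisms.Etale
import Literature.AlgebraicGeometry.Motives.FiniteEtaleFibreComplexPoints
import HarnessLib

/-!
# The number of geometric points in a fibre of a finite étale morphism is its degree, locally constant on the base

Layer `Literature/AlgebraicGeometry/Morphisms`, namespace `Literature.AlgebraicGeometry.Morphisms`.  Cell
`hodgecm-mathlib` (D-0151), F-DAG price sheet v0.4 §5b second-wave hand (h9) «local constancy of the type», FILE 1 of 2
(generic engine; author B-p02 (g12)); count-neutral capital, PROOF lane.  HC_CM is proved only modulo the 7 printed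
citations until rung 0 closes; this file asserts nothing about HC.

## Sources, verbatim

* [GortzWedhorn2020] (12.6), (12.6.1): for a finite locally free morphism `f : X → Y`, «the function
  `y ↦ rk_y(f_*𝒪_X)` is locally constant on `Y`; it is called the degree of `f`»; Prop. 12.21: the rank at `y` is
  `dim_{κ(y)} Γ(X_y, 𝒪_{X_y})`.  For `X_y` ÉTALE over a separably closed `κ(y) = Ω` this dimension is the number of
  `Ω`-points of `X_y` ([GortzWedhorn2023] Def. 18.34 / Prop. 18.38: a finite étale `Ω`-scheme is `∐ Spec Ω`).

## What is proved (theorems only; no `def`, no named fact, no instance, no notation, no `sorry`)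

For `q : G ⟶ S` FINITE and ÉTALE (Mathlib `IsFinite`, `Etale`; hence flat and of finite presentation) and a geometric
point `s : Spec Ω ⟶ S` (`Ω` separably closed), with `Mathlib`'s degree function `Scheme.Hom.finrank q : S → ℕ`:

* `finite_and_natCard_specOver_eq_finrank` — the `Ω`-points of `G` over `s`, `{x : Spec Ω ⟶ G // x ≫ q = s}`, are
  FINITE and their number is `q.finrank (s ⋆)` (`⋆` the point of `Spec Ω`): base change to the fibre
  `G_s → Spec Ω` (finite étale, same rank by Mathlib `Scheme.Hom.finrank_pullback_snd`) + the field case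
  ★ `Motives.finite_specHom_and_natCard_eq_of_finrank_eq` + the universal property of the fibre product;
* `natCard_specOver_eq_finrank`, `finite_specOver` — the two halves;
* **`natCard_specOver_eq_of_preconnectedSpace`** — over a (pre)CONNECTED base the number of geometric points in the
  fibre is the same at any two geometric points (possibly with different fields `Ω`, `Ω'`): the degree is locally
  constant (Mathlib `Scheme.Hom.isLocallyConstant_finrank`), hence constant.

## References
* [GortzWedhorn2020] U. Görtz, T. Wedhorn, *Algebraic Geometry I*, 2nd ed. (2020), §(12.6), (12.6.1),
  Prop. 12.21.
* [GortzWedhorn2023] U. Görtz, T. Wedhorn, *Algebraic Geometry II* (2023), Def. 18.34, Prop. 18.38.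
-/

noncomputable section

universe u

open CategoryTheory CategoryTheory.Limits AlgebraicGeometry

namespace Literature.AlgebraicGeometry.Morphisms

variable {G S : Scheme.{u}} (q : G ⟶ S)

/-- The `Ω`-points of `G` over a field-valued point `s : Spec Ω → S` correspond to the `Ω`-points (over `Spec Ω`) of
the fibre `G_s = G ×_S Spec Ω` ([GortzWedhorn2020] (4.7.1): `Hom_S(T, X) = Hom_{S'}(T, X ×_S S')`).
[cite: GortzWedhorn2020, Section (4.7), (4.7.1) (p. 108)] -/
theorem nonempty_specOver_equiv_specHom_snd {Ω : Type u} [Field Ω] (s : Spec (.of Ω) ⟶ S) :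
    Nonempty ({x : Spec (.of Ω) ⟶ G // x ≫ q = s} ≃
      {y : Spec (.of Ω) ⟶ pullback q s //
        y ≫ pullback.snd q s = Spec.map (CommRingCat.ofHom (algebraMap Ω Ω))}) := by
  have hid : Spec.map (CommRingCat.ofHom (algebraMap Ω Ω)) = 𝟙 (Spec (.of Ω)) := by
    rw [Algebra.algebraMap_self, CommRingCat.ofHom_id, Spec.map_id]
  refine ⟨{ toFun := fun x => ⟨pullback.lift x.1 (𝟙 _) (by rw [x.2, Category.id_comp]), by
              rw [pullback.lift_snd, hid]⟩
            invFun := fun y => ⟨y.1 ≫ pullback.fst q s, by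
              rw [Category.assoc, pullback.condition, ← Category.assoc, y.2, hid, Category.id_comp]⟩
            left_inv := fun x => Subtype.ext (pullback.lift_fst _ _ _)
            right_inv := fun y => Subtype.ext ?_ }⟩
  apply pullback.hom_ext
  · rw [pullback.lift_fst]
  · rw [pullback.lift_snd, y.2, hid]

variable [IsFinite q] [Etale q]

/-- **Geometric fibre cardinality = degree**: for `q : G → S` finite étale and a geometric point
`s : Spec Ω → S` (`Ω` separably closed), the `Ω`-points of `G` over `s` are finite in number, equal to the degree
`q.finrank` at the image point of `s` ([GortzWedhorn2020] Prop. 12.21 with (12.6.1); the fibre `G_s` is a finite étale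
`Ω`-scheme of that rank, Mathlib `Scheme.Hom.finrank_pullback_snd`, whose points are counted by ★
`Motives.finite_specHom_and_natCard_eq_of_finrank_eq`). [cite: GortzWedhorn2020, Prop. 12.21]
[cite: GortzWedhorn2020, (12.6.1)] -/
theorem finite_and_natCard_specOver_eq_finrank {Ω : Type u} [Field Ω] [IsSepClosed Ω] (s : Spec (.of Ω) ⟶ S) :
    Finite {x : Spec (.of Ω) ⟶ G // x ≫ q = s} ∧
      Nat.card {x : Spec (.of Ω) ⟶ G // x ≫ q = s} = q.finrank (s.base (IsLocalRing.closedPoint Ω)) := by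
  obtain ⟨e⟩ := nonempty_specOver_equiv_specHom_snd q s
  have hrk : ∀ y : ↥(Spec (CommRingCat.of Ω)),
      (pullback.snd q s).finrank y = q.finrank (s.base (IsLocalRing.closedPoint Ω)) := by
    intro y
    rw [Scheme.Hom.finrank_pullback_snd, Subsingleton.elim y (IsLocalRing.closedPoint Ω)]
  obtain ⟨hfin, hcard⟩ :=
    Literature.AlgebraicGeometry.Motives.finite_specHom_and_natCard_eq_of_finrank_eq (pullback.snd q s) hrk
  haveI := hfin
  exact ⟨Finite.of_equiv _ e.symm, (Nat.card_congr e).trans hcard⟩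

/-- The `Ω`-points of a finite étale `S`-scheme over a geometric point are finite in number.
[cite: GortzWedhorn2020, Prop. 12.21] -/
theorem finite_specOver {Ω : Type u} [Field Ω] [IsSepClosed Ω] (s : Spec (.of Ω) ⟶ S) :
    Finite {x : Spec (.of Ω) ⟶ G // x ≫ q = s} :=
  (finite_and_natCard_specOver_eq_finrank q s).1

/-- The number of `Ω`-points of a finite étale `S`-scheme over a geometric point is the degree at the image point.
[cite: GortzWedhorn2020, Prop. 12.21] [cite: GortzWedhorn2020, (12.6.1)] -/
theorem natCard_specOver_eq_finrank {Ω : Type u} [Field Ω] [IsSepClosed Ω] (s : Spec (.of Ω) ⟶ S) :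
    Nat.card {x : Spec (.of Ω) ⟶ G // x ≫ q = s} = q.finrank (s.base (IsLocalRing.closedPoint Ω)) :=
  (finite_and_natCard_specOver_eq_finrank q s).2

/-- **Over a connected base the number of geometric points in the fibres of a finite étale morphism is constant**:
for two geometric points `s : Spec Ω → S`, `t : Spec Ω' → S` (`Ω`, `Ω'` separably closed, possibly different) of a
preconnected `S`, `#G(s) = #G(t)` — the degree is a locally constant function on `S` ([GortzWedhorn2020] (12.6.1);
Mathlib `Scheme.Hom.isLocallyConstant_finrank`), hence constant. [cite: GortzWedhorn2020, (12.6.1)]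
[cite: GortzWedhorn2020, Prop. 12.21] -/
theorem natCard_specOver_eq_of_preconnectedSpace [PreconnectedSpace S] {Ω Ω' : Type u} [Field Ω] [IsSepClosed Ω]
    [Field Ω'] [IsSepClosed Ω'] (s : Spec (.of Ω) ⟶ S) (t : Spec (.of Ω') ⟶ S) :
    Nat.card {x : Spec (.of Ω) ⟶ G // x ≫ q = s} = Nat.card {y : Spec (.of Ω') ⟶ G // y ≫ q = t} := by
  rw [natCard_specOver_eq_finrank q s, natCard_specOver_eq_finrank q t]
  exact q.isLocallyConstant_finrank.apply_eq_of_preconnectedSpace _ _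

/-- The same with the degree made explicit: on a preconnected base, `#G(s) = q.finrank b` for EVERY `b ∈ S`.
[cite: GortzWedhorn2020, (12.6.1)] -/
theorem natCard_specOver_eq_finrank_of_preconnectedSpace [PreconnectedSpace S] {Ω : Type u} [Field Ω]
    [IsSepClosed Ω] (s : Spec (.of Ω) ⟶ S) (b : S) :
    Nat.card {x : Spec (.of Ω) ⟶ G // x ≫ q = s} = q.finrank b := by
  rw [natCard_specOver_eq_finrank q s]
  exact q.isLocallyConstant_finrank.apply_eq_of_preconnectedSpace _ _

end Literature.AlgebraicGeometry.Morphisms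

end
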